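import Summits.BirchSwinnertonDyer.BirchSwinnertonDyer.Theorems.ByReductionTypeAtTwoTowerLayerCert
import Literature.NumberTheory.EllipticCurves.IwasawaSelmerDualProofs
import HarnessLib

/-!
# The TOWER gap certificate from ONE layer count (upper bound only): the lower certificate is the
# kernel's `#X/(2,T)X ≥ 1` (route ByReductionTypeAtTwo, crux `OrdKatoHalfAtTwo`,
# item stmt-BirchSwinnertonDyer-19271; seat bsd-2adic-tower-1 GEN 2, part 11)

HONEST FRAMING (cell `bsd-2adic`, run/shared/lean/pub/bsd-2adic/, HUMAN RULINGS D-0036/D-0074): THEOREMS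
ONLY; nothing asserted; no definition; no new named fact; closes nothing by itself.

Parts 6–9 read the gap off TWO layer counts: a lower certificate `2^a ≤ #Sel_{2^∞}(E/ℚ_j)[2]` and an
upper one `#Sel_{2^∞}(E/ℚ_{j'})[2] ≤ 2^d`. The lower one can be dropped (`j = 0`, `a = 0`): the
`2`-torsion of `Sel_{2^∞}(E/ℚ_n)` is finite (tree: `KatoHalfPinch.finite_and_natCard_selmerLayer_pTorsion_le`
against the dual datum `W.selmerDualData κ hγ` of `IwasawaSelmerDualProofs`) and contains `0`, so
`2^0 ≤ #Sel_{2^∞}(E/ℚ_j)[2]` holds for free (`one_le_natCard_selmerLayer_twoTorsion`). Doors with ONE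
engine certificate (the layer-`j'` count) + `MissingLowerBoundAt`:
`towerGapAtTwo_of_layerSelmer_cert_upper` (arithmetic `2^d · 4 · ∏ C_ℓ^{2^{min(j',e_ℓ)}} < 2^{2^{j'} − 1}`,
i.e. `d_{j'} + Σ ≤ 2^{j'} − 4`: `ℚ(ζ₃₂)⁺` closes `d₃ + Σ ≤ 4`, e.g. tower-eng's STEP-0 row 2045b1
`d₃ = 3`, `Σ = 0`), `bsdp_two_/mazurMainConjecture_two_of_layerSelmer_cert_upper_of_missingLowerBoundAt`.
The two-count doors stay sharper by `d₀ − 2` bits… i.e. by `2` bits on the open block (`d₀ = 2`).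

References: R. Greenberg, LNM 1716 (1999), §3; K. Kato, Astérisque 295 (2004), Thm. 17.4.
-/

set_option autoImplicit false

noncomputable section

open scoped Classical MatrixGroups ModularForm

open NumberField IsDedekindDomain CongruenceSubgroup WeierstrassCurve Literature.NumberTheory.EllipticCurves
  Literature.NumberTheory.EllipticCurves.ModularForms Literature.NumberTheory.EllipticCurves.Rank1Residual
  Literature.NumberTheory.EllipticCurves.Rank1Residual.Typed
  Literature.NumberTheory.EllipticCurves.Greenberg1999
  Summit.BirchSwinnertonDyer.Rank1Residual.X1.MuLambda
  Summit.BirchSwinnertonDyer.Rank1Residual.X1.MuPart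
  Summit.BirchSwinnertonDyer.Rank1Residual.X1.ParitySqueeze
  Summit.BirchSwinnertonDyer.BirchSwinnertonDyer.Theorems.Rank1ResidualX1Defs
  Summit.BirchSwinnertonDyer.Rank1Residual.X5 Summit.BirchSwinnertonDyer.Rank1Residual.X5.O1
  Summit.BirchSwinnertonDyer.Rank1Residual.X5.TowerGap
  Summit.BirchSwinnertonDyer.Rank1Residual

namespace Summit.BirchSwinnertonDyer.BirchSwinnertonDyer.Theorems.KatoHalfPinch

section Curve

variable (W : WeierstrassCurve ℚ) [W.IsElliptic] [W.IsGloballyMinimal]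

omit [W.IsGloballyMinimal] in
/-- **The lower certificate for free**: for `W/ℚ` with odd torsion order, ANY `ℤ₂`-extension `κ` and
any layer `n`, `Sel_{2^∞}(E/ℚ_n)[2]` is finite and non-empty, so `2^0 ≤ #Sel_{2^∞}(E/ℚ_n)[2]` (part 1's
`finite_and_natCard_selmerLayer_pTorsion_le` against the dual datum `W.selmerDualData κ hγ` for a
topological generator `γ`, which exists by surjectivity of `κ`). [cite: GreenbergLNM1716, §3 Lemma 3.1 (p. 86)]
[cite: Mazur1972, §6] -/
theorem one_le_natCard_selmerLayer_twoTorsion (htors : ¬ 2 ∣ W.torsionOrder) (κ : ZpExtension ℚ 2)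
    (n : ℕ) : 2 ^ 0 ≤ Nat.card {z : W.selmerLayer κ n // 2 • z = 0} := by
  haveI : Fact (Nat.Prime 2) := ⟨Nat.prime_two⟩
  obtain ⟨γ, hγ⟩ := κ.surjective (Multiplicative.ofAdd 1)
  have hγ' : κ.IsTopGenerator γ := hγ
  let D : W.SelmerDualData κ γ := W.selmerDualData κ hγ'
  haveI : Module.Finite (IwasawaAlgebra 2) D.X := D.module_finite_holds hγ'
  have hK := Iwasawa.forall_smul_eq_zero_imp_of_not_dvd_torsionOrder W htors
  haveI := (finite_and_natCard_selmerLayer_pTorsion_le W κ D hK n).1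
  haveI : Nonempty {z : W.selmerLayer κ n // 2 • z = 0} := ⟨⟨0, smul_zero _⟩⟩
  rw [pow_zero]
  exact Nat.card_pos

/-- **The GAP certificate from ONE layer count** (decidable kernel data as in part 9): `W/ℚ` globally
minimal, good ordinary at `2`, odd torsion order; ONE layer `j'`; `P`, `C`, `e`, `k` with `hP`, `hΔ`,
`he`, `hC` as in `towerGapAtTwo_of_layerSelmer_cert`; the upper certificate
`#Sel_{2^∞}(E/ℚ_{j'})[2] ≤ 2^d`; arithmetic `2^d · 4 · ∏_{ℓ ∈ P} C_ℓ^{2^{min(j', e_ℓ)}} < 2^{2^{j'} − 1}`.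
Then `O1.TowerGapAtTwo W`. [cite: GreenbergLNM1716, §3 Lemmas 3.1, 3.3–3.5, Prop. 2.5]
[cite: SilvermanAEC2009, VII.1 Prop. 1.3, VII.5.1] -/
theorem towerGapAtTwo_of_layerSelmer_cert_upper
    (h33g : lemma33_localTowerKerPrimary_eq_bot_of_good.{0})
    (hM : lemma33_localTowerKerPrimary_cyclic_of_multiplicative.{0})
    (hA : lemma33_natCard_localTowerKerPrimary_le_four_of_additive.{0})
    (hS34 : lemma34_localTowerKerPrimary_cyclicExtension_rat)
    (hgo : GoodOrd W 2) (htors : ¬ 2 ∣ W.torsionOrder) {j' d : ℕ}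
    (P : Finset ℕ) (hP : ∀ ℓ ∈ P, ℓ.Prime ∧ ℓ ≠ 2)
    (hΔ : ∀ ℓ : ℕ, ℓ.Prime → ℓ ≠ 2 → (ℓ : ℤ) ∣ W.minimalDiscriminantInt → ℓ ∈ P)
    (C e k : ℕ → ℕ) (he : ∀ ℓ ∈ P, ¬ 2 ^ (e ℓ + 4) ∣ ℓ ^ 2 - 1)
    (hC : ∀ (ℓ : ℕ) [Fact ℓ.Prime], ℓ ∈ P →
      4 ≤ C ℓ ∨ (W.HasMultiplicativeReductionAtPrime ℓ ∧ 2 ≤ C ℓ) ∨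
        (W.HasMultiplicativeReductionAtPrime ℓ ∧ (ℓ : ℤ) ^ k ℓ ∣ W.minimalDiscriminantInt ∧
          ¬ (ℓ : ℤ) ^ (k ℓ + 1) ∣ W.minimalDiscriminantInt ∧ ¬ 2 ∣ k ℓ ∧ 1 ≤ C ℓ) ∨
        (¬ (ℓ : ℤ) ∣ W.minimalDiscriminantInt ∧ 1 ≤ C ℓ))
    (hup : ∀ κ : ZpExtension ℚ 2, κ.IsCyclotomic →
      Nat.card {z : W.selmerLayer κ j' // 2 • z = 0} ≤ 2 ^ d)
    (harith : 2 ^ d * 4 * ∏ ℓ ∈ P, C ℓ ^ 2 ^ min j' (e ℓ) < 2 ^ (2 ^ j' - 1)) :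
    TowerGapAtTwo W :=
  towerGapAtTwo_of_layerSelmer_cert W h33g hM hA hS34 hgo htors (Nat.zero_le j') P hP hΔ C e k he hC
    (fun κ _ ↦ one_le_natCard_selmerLayer_twoTorsion W htors κ 0) hup
    (by rw [pow_zero, Nat.add_zero]; exact harith)

/-- **Door (`Ш`-currency, ONE layer count) for `BSD(E,2)` at analytic rank `0`** on a
good-ordinary-at-`2` curve with odd torsion order: PRINT ×8 {`hmod`, `hGZK`, `h17`, `hEC`, `h33g`, `hM`,
`hA`, `hS34`} + CERTIFICATES {`hper₀`, decidable kernel data `P`/`C`/`e`/`k`, the layer-`j'` count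
`hup`, arithmetic, `MissingLowerBoundAt W 2`}. [cite: GreenbergLNM1716, Thm. 4.1 (p. 102), §3 Lemmas 3.1–3.5, Prop. 2.5]
[cite: Kato2004Asterisque, Thm. 17.4 (1)(2) (p. 273)] [cite: Miller2011LMS, Def. 1.1] -/
theorem bsdp_two_of_layerSelmer_cert_upper_of_missingLowerBoundAt
    (hmod : nonempty_modularParametrizationData) (hGZK : rank_eq_analyticRank_of_analyticRank_le_one)
    (h17 : ∀ [NeZero (W.conductorNorm ℤ)] (f : CuspForm (Gamma0 (W.conductorNorm ℤ)) 2),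
      kato_divisibility_allPrimes W 2 (f := f))
    (hEC : TwoAdicEulerCharRankZero W 0)
    (h33g : lemma33_localTowerKerPrimary_eq_bot_of_good.{0})
    (hM : lemma33_localTowerKerPrimary_cyclic_of_multiplicative.{0})
    (hA : lemma33_natCard_localTowerKerPrimary_le_four_of_additive.{0})
    (hS34 : lemma34_localTowerKerPrimary_cyclicExtension_rat)
    (hper₀ : ∀ [NeZero (W.conductorNorm ℤ)] (f : CuspForm (Gamma0 (W.conductorNorm ℤ)) 2),
      IsNewformOf W f → ∀ ϖ : ℚ, (ϖ : ℝ) * W.realPeriodRat = plusPeriod f → 0 ≤ padicValRat 2 ϖ)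
    (hgo : GoodOrd W 2) (hr : W.analyticRank = 0) (htors : ¬ 2 ∣ W.torsionOrder) {j' d : ℕ}
    (P : Finset ℕ) (hP : ∀ ℓ ∈ P, ℓ.Prime ∧ ℓ ≠ 2)
    (hΔ : ∀ ℓ : ℕ, ℓ.Prime → ℓ ≠ 2 → (ℓ : ℤ) ∣ W.minimalDiscriminantInt → ℓ ∈ P)
    (C e k : ℕ → ℕ) (he : ∀ ℓ ∈ P, ¬ 2 ^ (e ℓ + 4) ∣ ℓ ^ 2 - 1)
    (hC : ∀ (ℓ : ℕ) [Fact ℓ.Prime], ℓ ∈ P →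
      4 ≤ C ℓ ∨ (W.HasMultiplicativeReductionAtPrime ℓ ∧ 2 ≤ C ℓ) ∨
        (W.HasMultiplicativeReductionAtPrime ℓ ∧ (ℓ : ℤ) ^ k ℓ ∣ W.minimalDiscriminantInt ∧
          ¬ (ℓ : ℤ) ^ (k ℓ + 1) ∣ W.minimalDiscriminantInt ∧ ¬ 2 ∣ k ℓ ∧ 1 ≤ C ℓ) ∨
        (¬ (ℓ : ℤ) ∣ W.minimalDiscriminantInt ∧ 1 ≤ C ℓ))
    (hup : ∀ κ : ZpExtension ℚ 2, κ.IsCyclotomic →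
      Nat.card {z : W.selmerLayer κ j' // 2 • z = 0} ≤ 2 ^ d)
    (harith : 2 ^ d * 4 * ∏ ℓ ∈ P, C ℓ ^ 2 ^ min j' (e ℓ) < 2 ^ (2 ^ j' - 1))
    (hsha : MissingLowerBoundAt W 2) : BSDp W 2 :=
  EisensteinShaCurrency.bsdp_two_of_towerGap_of_missingLowerBoundAt W h17 hper₀ hEC hGZK hmod hgo hr
    (towerGapAtTwo_of_layerSelmer_cert_upper W h33g hM hA hS34 hgo htors P hP hΔ C e k he hC hup harith)
    hsha

/-- **Door (`Ш`-currency, ONE layer count): `MazurMainConjecture W 2`** (hence the item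
`OrdKatoHalfAtTwo` AT `W`) at a rank-`0` good-ordinary `W` with odd torsion order.
[cite: Kato2004Asterisque, Thm. 17.4 (1)(2) (p. 273)] [cite: GreenbergLNM1716, Thm. 4.1 (p. 102), §3 Lemmas 3.1–3.5, Prop. 2.5] -/
theorem mazurMainConjecture_two_of_layerSelmer_cert_upper_of_missingLowerBoundAt
    (hmod : nonempty_modularParametrizationData) (hGZK : rank_eq_analyticRank_of_analyticRank_le_one)
    (h17 : ∀ [NeZero (W.conductorNorm ℤ)] (f : CuspForm (Gamma0 (W.conductorNorm ℤ)) 2),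
      kato_divisibility_allPrimes W 2 (f := f))
    (hEC : TwoAdicEulerCharRankZero W 0)
    (h33g : lemma33_localTowerKerPrimary_eq_bot_of_good.{0})
    (hM : lemma33_localTowerKerPrimary_cyclic_of_multiplicative.{0})
    (hA : lemma33_natCard_localTowerKerPrimary_le_four_of_additive.{0})
    (hS34 : lemma34_localTowerKerPrimary_cyclicExtension_rat)
    (hper₀ : ∀ [NeZero (W.conductorNorm ℤ)] (f : CuspForm (Gamma0 (W.conductorNorm ℤ)) 2),
      IsNewformOf W f → ∀ ϖ : ℚ, (ϖ : ℝ) * W.realPeriodRat = plusPeriod f → 0 ≤ padicValRat 2 ϖ)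
    (hgo : GoodOrd W 2) (hr : W.analyticRank = 0) (htors : ¬ 2 ∣ W.torsionOrder) {j' d : ℕ}
    (P : Finset ℕ) (hP : ∀ ℓ ∈ P, ℓ.Prime ∧ ℓ ≠ 2)
    (hΔ : ∀ ℓ : ℕ, ℓ.Prime → ℓ ≠ 2 → (ℓ : ℤ) ∣ W.minimalDiscriminantInt → ℓ ∈ P)
    (C e k : ℕ → ℕ) (he : ∀ ℓ ∈ P, ¬ 2 ^ (e ℓ + 4) ∣ ℓ ^ 2 - 1)
    (hC : ∀ (ℓ : ℕ) [Fact ℓ.Prime], ℓ ∈ P →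
      4 ≤ C ℓ ∨ (W.HasMultiplicativeReductionAtPrime ℓ ∧ 2 ≤ C ℓ) ∨
        (W.HasMultiplicativeReductionAtPrime ℓ ∧ (ℓ : ℤ) ^ k ℓ ∣ W.minimalDiscriminantInt ∧
          ¬ (ℓ : ℤ) ^ (k ℓ + 1) ∣ W.minimalDiscriminantInt ∧ ¬ 2 ∣ k ℓ ∧ 1 ≤ C ℓ) ∨
        (¬ (ℓ : ℤ) ∣ W.minimalDiscriminantInt ∧ 1 ≤ C ℓ))
    (hup : ∀ κ : ZpExtension ℚ 2, κ.IsCyclotomic →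
      Nat.card {z : W.selmerLayer κ j' // 2 • z = 0} ≤ 2 ^ d)
    (harith : 2 ^ d * 4 * ∏ ℓ ∈ P, C ℓ ^ 2 ^ min j' (e ℓ) < 2 ^ (2 ^ j' - 1))
    (hsha : MissingLowerBoundAt W 2) : MazurMainConjecture W 2 :=
  EisensteinShaCurrency.mazurMainConjecture_two_of_towerGap_of_missingLowerBoundAt W h17 hper₀ hEC
    hGZK hmod hgo hr
    (towerGapAtTwo_of_layerSelmer_cert_upper W h33g hM hA hS34 hgo htors P hP hΔ C e k he hC hup harith)
    hsha

end Curve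

end Summit.BirchSwinnertonDyer.BirchSwinnertonDyer.Theorems.KatoHalfPinch

end
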